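import Summits.CriticalPhenomena.PercolationContinuityZ3.Theorems.PercNearOneGluingNoHeavyLowerTailQuantitativeAntitheticHarris
import HarnessLib

/-!
# Antithetic covariance monotonicity (DS) on the cube (BENCH row M2-R98, PROOFS §P69 (a))

Support file (`--supports stmt-CriticalPhenomena-4575`), prover seat `prim-rate-mine-2` (lane prim-rate, constants-miner (c);
`run/shared/lean/prim/prim-rate/prim-rate-mine-2/PROOFS.md` §P69).  No definitions, no named facts, no sorries; standard axioms; Mathlib +
the lane's antithetic Harris file only.

SETTING.  `s : Finset α` is the red pair set of the p = ½ complementary («antithetic») coupling of PROOFS §P68/§P69 and `sᶜ` the blue one.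
An increasing event of the graph `G = H + e` read on `(s, colour of e)` is a PAIR of families `𝒜₀ ⊆ 𝒜₁` of subsets of `α = E(H)`
(`𝒜₀` = the event with `e` absent = read in `G − e`, `𝒜₁` = with `e` present = read in `G / e`); for `𝒜 = {b ↔ x}`, `ℬ = {u ↔ x}` the
antithetic covariance sums of §P68 are, with `𝟙` the 0/1 indicators,
`2·S(G) = Σ_s [(𝟙_{𝒜₁}(s) − 𝟙_{𝒜₀}(sᶜ))(𝟙_{ℬ₁}(s) − 𝟙_{ℬ₀}(sᶜ)) + (𝟙_{𝒜₀}(s) − 𝟙_{𝒜₁}(sᶜ))(𝟙_{ℬ₀}(s) − 𝟙_{ℬ₁}(sᶜ))]` (`e` red / `e` blue),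
`2·S(G − e) = Σ_s (𝟙_{𝒜₀}(s) − 𝟙_{𝒜₀}(sᶜ))(𝟙_{ℬ₀}(s) − 𝟙_{ℬ₀}(sᶜ))`, `2·S(G / e) = Σ_s (𝟙_{𝒜₁}(s) − 𝟙_{𝒜₁}(sᶜ))(𝟙_{ℬ₁}(s) − 𝟙_{ℬ₁}(sᶜ))`.

* `CSH.antithetic_pairSum_identity` — the exact ONE-PAIR IDENTITY `2S(G) − 2S(G−e) = 2S(G/e) + N_×` (a pointwise polynomial identity, no
  hypotheses): `N_× = Σ_s [(𝟙_{𝒜₁}−𝟙_{𝒜₀})(s)·(𝟙_{ℬ₁}−𝟙_{ℬ₀})(sᶜ) + (𝟙_{𝒜₁}−𝟙_{𝒜₀})(sᶜ)·(𝟙_{ℬ₁}−𝟙_{ℬ₀})(s)]`.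
* `CSH.antithetic_sum_eq_two_mul` — for any families, `Σ_s (𝟙_𝒜(s) − 𝟙_𝒜(sᶜ))(𝟙_ℬ(s) − 𝟙_ℬ(sᶜ)) = 2(#(𝒜 ∩ ℬ) − #{s ∈ 𝒜 : sᶜ ∈ ℬ})`,
  hence `≥ 0` for UP-SETS by `CSH.card_filter_compl_mem_le_card_inter` (`CSH.antithetic_sum_nonneg`; this is `S(H) ≥ 0` of §P68 (b)(i)).
* `CSH.antithetic_covSum_mono` — **THEOREM (DS) of §P69 (a)**: for `𝒜₀ ⊆ 𝒜₁`, `ℬ₀ ⊆ ℬ₁` with `𝒜₁, ℬ₁` up-sets,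
  `Σ_s (𝟙_{𝒜₀}(s) − 𝟙_{𝒜₀}(sᶜ))(𝟙_{ℬ₀}(s) − 𝟙_{ℬ₀}(sᶜ)) ≤ Σ_s [(𝟙_{𝒜₁}(s) − 𝟙_{𝒜₀}(sᶜ))(𝟙_{ℬ₁}(s) − 𝟙_{ℬ₀}(sᶜ)) + (𝟙_{𝒜₀}(s) − 𝟙_{𝒜₁}(sᶜ))(𝟙_{ℬ₀}(s) − 𝟙_{ℬ₁}(sᶜ))]`,
  i.e. `S(G − e) ≤ S(G)` for EVERY pair `e` of every finite graph and all `x, b, u`: the raw count #concordant − #discordant never decreases when a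
  pair is added (in expectation it is at most halved).  This is the `C → ∞` slope of the deletion inequality (D) of BENCH row M2-R99.
[cite: Harris1960, Lemma 4.1 (p. 16)] [cite: AhlswedeDaykin1978, Thm. 1 (p. 183)]
-/

namespace Summit.CriticalPhenomena.PercolationContinuityZ3.Theorems.CSH

open Finset
open scoped FinsetFamily

variable {α : Type*} [Fintype α] [DecidableEq α]

/-- **The one-pair identity for the antithetic covariance sum** (PROOFS §P69 (a)): with 0/1 indicators of four arbitrary families,
`Σ_s [(𝟙_{𝒜₁}(s)−𝟙_{𝒜₀}(sᶜ))(𝟙_{ℬ₁}(s)−𝟙_{ℬ₀}(sᶜ)) + (𝟙_{𝒜₀}(s)−𝟙_{𝒜₁}(sᶜ))(𝟙_{ℬ₀}(s)−𝟙_{ℬ₁}(sᶜ)) − (𝟙_{𝒜₀}(s)−𝟙_{𝒜₀}(sᶜ))(𝟙_{ℬ₀}(s)−𝟙_{ℬ₀}(sᶜ))]`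
`= Σ_s (𝟙_{𝒜₁}(s)−𝟙_{𝒜₁}(sᶜ))(𝟙_{ℬ₁}(s)−𝟙_{ℬ₁}(sᶜ)) + Σ_s [(𝟙_{𝒜₁}(s)−𝟙_{𝒜₀}(s))(𝟙_{ℬ₁}(sᶜ)−𝟙_{ℬ₀}(sᶜ)) + (𝟙_{𝒜₁}(sᶜ)−𝟙_{𝒜₀}(sᶜ))(𝟙_{ℬ₁}(s)−𝟙_{ℬ₀}(s))]`
— `2S(G) − 2S(G−e) = 2S(G/e) + N_×`; the mixed second difference of a bilinear form. [cite: Harris1960, Lemma 4.1 (p. 16)] -/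
theorem antithetic_pairSum_identity (𝒜₀ 𝒜₁ ℬ₀ ℬ₁ : Finset (Finset α)) :
    (∑ s : Finset α,
        (((if s ∈ 𝒜₁ then (1:ℤ) else 0) - (if sᶜ ∈ 𝒜₀ then (1:ℤ) else 0)) *
            ((if s ∈ ℬ₁ then (1:ℤ) else 0) - (if sᶜ ∈ ℬ₀ then (1:ℤ) else 0)) +
          ((if s ∈ 𝒜₀ then (1:ℤ) else 0) - (if sᶜ ∈ 𝒜₁ then (1:ℤ) else 0)) *
            ((if s ∈ ℬ₀ then (1:ℤ) else 0) - (if sᶜ ∈ ℬ₁ then (1:ℤ) else 0)) -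
          ((if s ∈ 𝒜₀ then (1:ℤ) else 0) - (if sᶜ ∈ 𝒜₀ then (1:ℤ) else 0)) *
            ((if s ∈ ℬ₀ then (1:ℤ) else 0) - (if sᶜ ∈ ℬ₀ then (1:ℤ) else 0))))
      = (∑ s : Finset α,
          ((if s ∈ 𝒜₁ then (1:ℤ) else 0) - (if sᶜ ∈ 𝒜₁ then (1:ℤ) else 0)) *
            ((if s ∈ ℬ₁ then (1:ℤ) else 0) - (if sᶜ ∈ ℬ₁ then (1:ℤ) else 0)))
        + ∑ s : Finset α,
          (((if s ∈ 𝒜₁ then (1:ℤ) else 0) - (if s ∈ 𝒜₀ then (1:ℤ) else 0)) *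
              ((if sᶜ ∈ ℬ₁ then (1:ℤ) else 0) - (if sᶜ ∈ ℬ₀ then (1:ℤ) else 0)) +
            ((if sᶜ ∈ 𝒜₁ then (1:ℤ) else 0) - (if sᶜ ∈ 𝒜₀ then (1:ℤ) else 0)) *
              ((if s ∈ ℬ₁ then (1:ℤ) else 0) - (if s ∈ ℬ₀ then (1:ℤ) else 0))) := by
  rw [← Finset.sum_add_distrib]
  refine Finset.sum_congr rfl fun s _ => ?_
  ring

/-- **The antithetic covariance sum in closed form**: for any two families `𝒜, ℬ` of subsets of a finite type,
`Σ_s (𝟙_𝒜(s) − 𝟙_𝒜(sᶜ))(𝟙_ℬ(s) − 𝟙_ℬ(sᶜ)) = 2·(#(𝒜 ∩ ℬ) − #{s ∈ 𝒜 : sᶜ ∈ ℬ})` (= 2·(#concordant − #discordant) of PROOFS §P68;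
the complement involution identifies the two diagonal and the two off-diagonal terms). [cite: Harris1960, Lemma 4.1 (p. 16)] -/
theorem antithetic_sum_eq_two_mul (𝒜 ℬ : Finset (Finset α)) :
    (∑ s : Finset α,
        ((if s ∈ 𝒜 then (1:ℤ) else 0) - (if sᶜ ∈ 𝒜 then (1:ℤ) else 0)) *
          ((if s ∈ ℬ then (1:ℤ) else 0) - (if sᶜ ∈ ℬ then (1:ℤ) else 0)))
      = 2 * ((#(𝒜 ∩ ℬ) : ℤ) - (#(𝒜.filter fun s => sᶜ ∈ ℬ) : ℤ)) := by
  -- the four products of indicators, summed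
  have hAB : (∑ s : Finset α, (if s ∈ 𝒜 then (1:ℤ) else 0) * (if s ∈ ℬ then (1:ℤ) else 0)) = (#(𝒜 ∩ ℬ) : ℤ) := by
    have : ∀ s : Finset α, (if s ∈ 𝒜 then (1:ℤ) else 0) * (if s ∈ ℬ then (1:ℤ) else 0)
        = if s ∈ 𝒜 ∩ ℬ then (1:ℤ) else 0 := fun s => by
      by_cases ha : s ∈ 𝒜 <;> by_cases hb : s ∈ ℬ <;> simp [ha, hb]
    simp_rw [this]
    rw [Finset.sum_boole]
    congr 2; ext s; simp
  have hAcB : (∑ s : Finset α, (if s ∈ 𝒜 then (1:ℤ) else 0) * (if sᶜ ∈ ℬ then (1:ℤ) else 0))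
      = (#(𝒜.filter fun s => sᶜ ∈ ℬ) : ℤ) := by
    have : ∀ s : Finset α, (if s ∈ 𝒜 then (1:ℤ) else 0) * (if sᶜ ∈ ℬ then (1:ℤ) else 0)
        = if s ∈ 𝒜.filter (fun s => sᶜ ∈ ℬ) then (1:ℤ) else 0 := fun s => by
      by_cases ha : s ∈ 𝒜 <;> by_cases hb : sᶜ ∈ ℬ <;> simp [ha, hb]
    simp_rw [this]
    rw [Finset.sum_boole]
    congr 2; ext s; simp
  -- the complement involution `s ↦ sᶜ` as a permutation of `Finset α`
  have hinv : Function.Involutive (compl : Finset α → Finset α) := compl_involutive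
  have hcAcB : (∑ s : Finset α, (if sᶜ ∈ 𝒜 then (1:ℤ) else 0) * (if sᶜ ∈ ℬ then (1:ℤ) else 0)) = (#(𝒜 ∩ ℬ) : ℤ) := by
    rw [← hAB]
    exact Equiv.sum_comp hinv.toPerm (fun s => (if s ∈ 𝒜 then (1:ℤ) else 0) * (if s ∈ ℬ then (1:ℤ) else 0))
  have hcAB : (∑ s : Finset α, (if sᶜ ∈ 𝒜 then (1:ℤ) else 0) * (if s ∈ ℬ then (1:ℤ) else 0))
      = (#(𝒜.filter fun s => sᶜ ∈ ℬ) : ℤ) := by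
    rw [← hAcB]
    have := Equiv.sum_comp hinv.toPerm (fun s => (if s ∈ 𝒜 then (1:ℤ) else 0) * (if sᶜ ∈ ℬ then (1:ℤ) else 0))
    simp only [Function.Involutive.coe_toPerm, compl_compl] at this
    exact this
  -- expand the product and sum
  have hexp : ∀ s : Finset α,
      ((if s ∈ 𝒜 then (1:ℤ) else 0) - (if sᶜ ∈ 𝒜 then (1:ℤ) else 0)) *
          ((if s ∈ ℬ then (1:ℤ) else 0) - (if sᶜ ∈ ℬ then (1:ℤ) else 0))
        = (if s ∈ 𝒜 then (1:ℤ) else 0) * (if s ∈ ℬ then (1:ℤ) else 0)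
          - (if s ∈ 𝒜 then (1:ℤ) else 0) * (if sᶜ ∈ ℬ then (1:ℤ) else 0)
          - (if sᶜ ∈ 𝒜 then (1:ℤ) else 0) * (if s ∈ ℬ then (1:ℤ) else 0)
          + (if sᶜ ∈ 𝒜 then (1:ℤ) else 0) * (if sᶜ ∈ ℬ then (1:ℤ) else 0) := fun s => by ring
  simp_rw [hexp]
  rw [Finset.sum_add_distrib, Finset.sum_sub_distrib, Finset.sum_sub_distrib, hAB, hAcB, hcAB, hcAcB]
  ring

/-- **Antithetic Harris in sum form** (`S(H) ≥ 0`, PROOFS §P68 (b)(i)): for UP-SETS `𝒜, ℬ`,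
`0 ≤ Σ_s (𝟙_𝒜(s) − 𝟙_𝒜(sᶜ))(𝟙_ℬ(s) − 𝟙_ℬ(sᶜ))` — by `antithetic_sum_eq_two_mul` and `card_filter_compl_mem_le_card_inter`.
[cite: Harris1960, Lemma 4.1 (p. 16)] -/
theorem antithetic_sum_nonneg {𝒜 ℬ : Finset (Finset α)}
    (h𝒜 : IsUpperSet (𝒜 : Set (Finset α))) (hℬ : IsUpperSet (ℬ : Set (Finset α))) :
    0 ≤ ∑ s : Finset α,
        ((if s ∈ 𝒜 then (1:ℤ) else 0) - (if sᶜ ∈ 𝒜 then (1:ℤ) else 0)) *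
          ((if s ∈ ℬ then (1:ℤ) else 0) - (if sᶜ ∈ ℬ then (1:ℤ) else 0)) := by
  rw [antithetic_sum_eq_two_mul]
  have h := card_filter_compl_mem_le_card_inter h𝒜 hℬ
  have h' : (#(𝒜.filter fun s => sᶜ ∈ ℬ) : ℤ) ≤ (#(𝒜 ∩ ℬ) : ℤ) := by exact_mod_cast h
  linarith

/-- **THEOREM (DS) — antithetic covariance monotonicity** (BENCH row M2-R98, PROOFS §P69 (a)): for families `𝒜₀ ⊆ 𝒜₁`, `ℬ₀ ⊆ ℬ₁`
of subsets of a finite type with `𝒜₁, ℬ₁` up-sets,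
`Σ_s (𝟙_{𝒜₀}(s)−𝟙_{𝒜₀}(sᶜ))(𝟙_{ℬ₀}(s)−𝟙_{ℬ₀}(sᶜ)) ≤ Σ_s [(𝟙_{𝒜₁}(s)−𝟙_{𝒜₀}(sᶜ))(𝟙_{ℬ₁}(s)−𝟙_{ℬ₀}(sᶜ)) + (𝟙_{𝒜₀}(s)−𝟙_{𝒜₁}(sᶜ))(𝟙_{ℬ₀}(s)−𝟙_{ℬ₁}(sᶜ))]`.
READING: `𝒜_t = {b ↔ x}`, `ℬ_t = {u ↔ x}` with the extra pair `e` absent (`t = 0`, the graph `G − e`) / present (`t = 1`, `G / e`):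
the left side is `2·S(G − e)`, the right side is `2·S(G)` (`e` red + `e` blue), so **`S(G − e) ≤ S(G)` for every pair `e` of every finite
graph and all `x, b, u`** — the C-slope of the deletion inequality (D) of BENCH row M2-R99.  PROOF: the identity `antithetic_pairSum_identity`,
`antithetic_sum_nonneg` for `𝒜₁, ℬ₁`, and the cross terms are products of two non-negative differences (`𝒜₀ ⊆ 𝒜₁`, `ℬ₀ ⊆ ℬ₁`).
[cite: Harris1960, Lemma 4.1 (p. 16)] -/
theorem antithetic_covSum_mono {𝒜₀ 𝒜₁ ℬ₀ ℬ₁ : Finset (Finset α)}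
    (h𝒜 : 𝒜₀ ⊆ 𝒜₁) (hℬ : ℬ₀ ⊆ ℬ₁)
    (up𝒜 : IsUpperSet (𝒜₁ : Set (Finset α))) (upℬ : IsUpperSet (ℬ₁ : Set (Finset α))) :
    (∑ s : Finset α,
        ((if s ∈ 𝒜₀ then (1:ℤ) else 0) - (if sᶜ ∈ 𝒜₀ then (1:ℤ) else 0)) *
          ((if s ∈ ℬ₀ then (1:ℤ) else 0) - (if sᶜ ∈ ℬ₀ then (1:ℤ) else 0)))
      ≤ ∑ s : Finset α,
        (((if s ∈ 𝒜₁ then (1:ℤ) else 0) - (if sᶜ ∈ 𝒜₀ then (1:ℤ) else 0)) *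
            ((if s ∈ ℬ₁ then (1:ℤ) else 0) - (if sᶜ ∈ ℬ₀ then (1:ℤ) else 0)) +
          ((if s ∈ 𝒜₀ then (1:ℤ) else 0) - (if sᶜ ∈ 𝒜₁ then (1:ℤ) else 0)) *
            ((if s ∈ ℬ₀ then (1:ℤ) else 0) - (if sᶜ ∈ ℬ₁ then (1:ℤ) else 0))) := by
  have hid := antithetic_pairSum_identity 𝒜₀ 𝒜₁ ℬ₀ ℬ₁
  have hS1 := antithetic_sum_nonneg up𝒜 upℬ
  -- the cross terms are non-negative pointwise
  have hN : 0 ≤ ∑ s : Finset α,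
      (((if s ∈ 𝒜₁ then (1:ℤ) else 0) - (if s ∈ 𝒜₀ then (1:ℤ) else 0)) *
          ((if sᶜ ∈ ℬ₁ then (1:ℤ) else 0) - (if sᶜ ∈ ℬ₀ then (1:ℤ) else 0)) +
        ((if sᶜ ∈ 𝒜₁ then (1:ℤ) else 0) - (if sᶜ ∈ 𝒜₀ then (1:ℤ) else 0)) *
          ((if s ∈ ℬ₁ then (1:ℤ) else 0) - (if s ∈ ℬ₀ then (1:ℤ) else 0))) := by
    refine Finset.sum_nonneg fun s _ => ?_
    have h1 : 0 ≤ (if s ∈ 𝒜₁ then (1:ℤ) else 0) - (if s ∈ 𝒜₀ then (1:ℤ) else 0) := by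
      by_cases h0 : s ∈ 𝒜₀
      · have h1 : s ∈ 𝒜₁ := h𝒜 h0
        simp [h0, h1]
      · by_cases h1 : s ∈ 𝒜₁ <;> simp [h0, h1]
    have h2 : 0 ≤ (if sᶜ ∈ ℬ₁ then (1:ℤ) else 0) - (if sᶜ ∈ ℬ₀ then (1:ℤ) else 0) := by
      by_cases h0 : sᶜ ∈ ℬ₀
      · have h1 : sᶜ ∈ ℬ₁ := hℬ h0
        simp [h0, h1]
      · by_cases h1 : sᶜ ∈ ℬ₁ <;> simp [h0, h1]
    have h3 : 0 ≤ (if sᶜ ∈ 𝒜₁ then (1:ℤ) else 0) - (if sᶜ ∈ 𝒜₀ then (1:ℤ) else 0) := by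
      by_cases h0 : sᶜ ∈ 𝒜₀
      · have h1 : sᶜ ∈ 𝒜₁ := h𝒜 h0
        simp [h0, h1]
      · by_cases h1 : sᶜ ∈ 𝒜₁ <;> simp [h0, h1]
    have h4 : 0 ≤ (if s ∈ ℬ₁ then (1:ℤ) else 0) - (if s ∈ ℬ₀ then (1:ℤ) else 0) := by
      by_cases h0 : s ∈ ℬ₀
      · have h1 : s ∈ ℬ₁ := hℬ h0
        simp [h0, h1]
      · by_cases h1 : s ∈ ℬ₁ <;> simp [h0, h1]
    exact add_nonneg (mul_nonneg h1 h2) (mul_nonneg h3 h4)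
  -- assemble: RHS − LHS = S₁ + N ≥ 0, where `hid` is `Σ (RHS-summand − LHS-summand) = S₁ + N`
  have hsplit : (∑ s : Finset α,
        (((if s ∈ 𝒜₁ then (1:ℤ) else 0) - (if sᶜ ∈ 𝒜₀ then (1:ℤ) else 0)) *
            ((if s ∈ ℬ₁ then (1:ℤ) else 0) - (if sᶜ ∈ ℬ₀ then (1:ℤ) else 0)) +
          ((if s ∈ 𝒜₀ then (1:ℤ) else 0) - (if sᶜ ∈ 𝒜₁ then (1:ℤ) else 0)) *
            ((if s ∈ ℬ₀ then (1:ℤ) else 0) - (if sᶜ ∈ ℬ₁ then (1:ℤ) else 0)) -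
          ((if s ∈ 𝒜₀ then (1:ℤ) else 0) - (if sᶜ ∈ 𝒜₀ then (1:ℤ) else 0)) *
            ((if s ∈ ℬ₀ then (1:ℤ) else 0) - (if sᶜ ∈ ℬ₀ then (1:ℤ) else 0))))
      = (∑ s : Finset α,
          (((if s ∈ 𝒜₁ then (1:ℤ) else 0) - (if sᶜ ∈ 𝒜₀ then (1:ℤ) else 0)) *
              ((if s ∈ ℬ₁ then (1:ℤ) else 0) - (if sᶜ ∈ ℬ₀ then (1:ℤ) else 0)) +
            ((if s ∈ 𝒜₀ then (1:ℤ) else 0) - (if sᶜ ∈ 𝒜₁ then (1:ℤ) else 0)) *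
              ((if s ∈ ℬ₀ then (1:ℤ) else 0) - (if sᶜ ∈ ℬ₁ then (1:ℤ) else 0))))
        - ∑ s : Finset α,
          ((if s ∈ 𝒜₀ then (1:ℤ) else 0) - (if sᶜ ∈ 𝒜₀ then (1:ℤ) else 0)) *
            ((if s ∈ ℬ₀ then (1:ℤ) else 0) - (if sᶜ ∈ ℬ₀ then (1:ℤ) else 0)) := by
    rw [← Finset.sum_sub_distrib]
  linarith [hid, hS1, hN, hsplit]

end Summit.CriticalPhenomena.PercolationContinuityZ3.Theorems.CSH
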